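import Summits.CriticalPhenomena.PercolationContinuityZ3.Theorems.Transplant.ThreeQuarterSlabArms
import HarnessLib

/-!
# The THREE-QUARTER SLAB `𝕋ℚ_k = {x ∈ S_k | x₁ ≥ 0 ∨ x₂ ≥ 0}` — a NON-CONVEX slab domain: the station design with a three-event chain for the
# bottom face (uniqueness of the infinite cluster at every density is the sequel)

builds on p205010 (kernel theorem, internal audit signed; external expert review pending) — NOT used in this file.
Lane `prim-bschramm`, seat `prim-bschramm-p2` (gen 23; class C1b, METHOD = input substitution; memo `HOME/bschramm/P2-LATTICES.md` §76);
helper file (`--supports stmt-CriticalPhenomena-4575 --as helper`).  The three-quarter slab is the union of two half-slabs overlapping in a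
quarter-slab; it is connected "thickly" (contrast: two quarter-slabs glued through a CUT VERTEX have `N ∈ {1,2}` random above `p_c(S_k)`,
`BridgedQuarterSlabs`).  Its inner boundary has all FOUR faces (gen 22 open item 4); the bottom face `u₁ = −N` (`u₂ ≥ 0`) cannot see a station
above the box, so its vertices are joined by a CHAIN of three increasing events: a thin arm in the `+x₂` direction leaning `−e₁` from `u − e₁`
(`A₁`, a swapped `steepSet4`), crossed below-right of the box by a thin vertical CONNECTOR arm `A₂` from `c = (u₀, −(4N+6), N+2)`, which in turn is
crossed by the station's sweep.  Constants (`N ≥ k+1`): `Ω = (0, N+1, −(3N+5))`, right end `Z = 3N+5`, tops `T = 4N+6`, `T₂ = 3N+5`, window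
`M = k + 4N + 6`, `R = 2k + 2` extra edges, `q = α₄·α·α₄`.
Bricks: `ThreeQuarterSlabArms` (`link_regions`, `openConnVia_trans`, the swapped thin arm and `exists_swapArm_bound`), `RationalHalfSlabDesign`
(`innerBdry_faces`, `move_apex_cyl_region`).  Here: `𝕋ℚ_k` is cylindrical, its faces (`tq_innerBdry`: left face ⇒ `u₁ ≥ 0`, bottom face ⇒
`u₂ ≥ 0`), the station's region, and **`tq_vertex_design`**.
[cite: AizenmanChayesChayesFrohlichRusso1983, §4 Thm 4.4, Lemma 4.2 (a), Lemma 4.3] [cite: DuminilCopinSidoraviciusTassion2016, Thm. 1 and §2] -/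

noncomputable section

namespace Summit.CriticalPhenomena.PercolationContinuityZ3.Theorems.Transplant

namespace ThreeQuarterSlab

open MeasureTheory Literature.Probability.Percolation Literature.Probability.LatticeModels SimpleGraph HSU OrthantUniq HalfSlabUniq
  ConeSlabUniq ThinConeSlab RationalHalfSlab Filter
open scoped Classical Topology

variable {k : ℕ} {N : ℕ}

/-! ## The three-quarter slab: faces and the design -/

/-- Membership in `𝕋ℚ_k`. [folklore] -/
theorem mem_tq_iff {x : Site 3} :
    x ∈ {x : Site 3 | x ∈ slab 3 k ∧ (0 ≤ x 1 ∨ 0 ≤ x 2)} ↔ (0 ≤ x 0 ∧ x 0 ≤ (k : ℤ)) ∧ (0 ≤ x 1 ∨ 0 ≤ x 2) := Iff.rfl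

/-- `𝕋ℚ_k` is cylindrical. [folklore] -/
theorem tq_cyl : ∀ x ∈ {x : Site 3 | x ∈ slab 3 k ∧ (0 ≤ x 1 ∨ 0 ≤ x 2)}, ∀ y ∈ slab 3 k, y 1 = x 1 → y 2 = x 2 →
    y ∈ {x : Site 3 | x ∈ slab 3 k ∧ (0 ≤ x 1 ∨ 0 ≤ x 2)} := by
  intro x hx y hy h1 h2
  exact ⟨hy, by rw [h1, h2]; exact hx.2⟩

/-- **The four faces of the inner boundary in `𝕋ℚ_k`** (`N ≥ k+1`): top `u₁ = N`; right `u₂ = N`; left `u₂ = −N` with `u₁ ≥ 0`; bottom `u₁ = −N`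
with `u₂ ≥ 0`. [cite: AizenmanChayesChayesFrohlichRusso1983, §4 (4.26)] -/
theorem tq_innerBdry (hN : k + 1 ≤ N) {u : Site 3} (hu : u ∈ boxSet 3 N)
    (hw : ∃ w, w ∉ boxSet 3 N ∧ (withinGraph (zdGraph 3) {x : Site 3 | x ∈ slab 3 k ∧ (0 ≤ x 1 ∨ 0 ≤ x 2)}).Adj u w) :
    u ∈ {x : Site 3 | x ∈ slab 3 k ∧ (0 ≤ x 1 ∨ 0 ≤ x 2)} ∧
      (u 1 = N ∨ u 2 = N ∨ (u 2 = -(N : ℤ) ∧ 0 ≤ u 1) ∨ (u 1 = -(N : ℤ) ∧ 0 ≤ u 2)) := by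
  obtain ⟨huD, hface⟩ := innerBdry_faces (fun _ hx => hx.1) hN hu hw
  refine ⟨huD, ?_⟩
  rcases hface with ⟨h, -⟩ | ⟨h, -⟩ | ⟨h, hD⟩ | ⟨h, hD⟩
  · exact Or.inl h
  · exact Or.inr (Or.inl h)
  · right; right; left
    have h2 := (mem_tq_iff.1 hD).2
    simp only [Pi.sub_apply, Pi.single_eq_same, Pi.single_eq_of_ne (show (1 : Fin 3) ≠ 2 by decide), sub_zero] at h2
    exact ⟨h, by omega⟩
  · right; right; right
    have h2 := (mem_tq_iff.1 hD).2
    simp only [Pi.sub_apply, Pi.single_eq_same, Pi.single_eq_of_ne (show (2 : Fin 3) ≠ 1 by decide), sub_zero] at h2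
    exact ⟨h, by omega⟩

/-- **The station's region in `𝕋ℚ_k`**: `Ω = (0, N+1, −(3N+5))`, `Z = 3N+5`, `T = 4N+6`: inside the domain (`x₁ ≥ N+1 ≥ 0`), off the box, below
`T`. [folklore] -/
theorem tq_station_props {x : Site 3} (hx : x ∈ shallowReg k ![0, (N : ℤ) + 1, -(3 * (N : ℤ) + 5)] (3 * (N : ℤ) + 5)) :
    x ∈ {x : Site 3 | x ∈ slab 3 k ∧ (0 ≤ x 1 ∨ 0 ≤ x 2)} ∧ x ∉ boxSet 3 N ∧ x 1 ≤ 4 * (N : ℤ) + 6 := by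
  obtain ⟨h0, h1, h2, h3, hZ⟩ := shallowReg_props hx
  simp only [Matrix.cons_val_one, Matrix.cons_val_zero, Matrix.cons_val] at h1 h2 h3
  exact ⟨⟨h0, Or.inl (by omega)⟩, not_mem_boxSet_of_lt (j := 1) (by rw [abs_of_nonneg (by omega)]; omega), by omega⟩

/-- **The design at an inner-boundary vertex of the three-quarter slab** (`N ≥ k + 1`; `α₄` a thin-arm bound, `αₛ` a swapped-arm bound, `A` a slab arm
kit at `p'`): an increasing event, measurable, determined by the edges of `[-M,M]³` (`M = k + 4N + 6`), of `P_{p'} ≥ α₄·α·αₛ`, on which `≤ 2k + 2` extra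
open edges join `u` to the station `Ω = (0, N+1, −(3N+5))` through open exterior steps of `𝕋ℚ_k` — top/right/left faces by one thin arm × the sweep,
the BOTTOM face by the chain (swapped arm from `u − e₁`) × (connector arm from `(u₀, −(4N+6), N+2)`) × (sweep).
[cite: AizenmanChayesChayesFrohlichRusso1983, §4 Cor. to Lemma 4.3, Lemma 4.2 (a)] -/
theorem tq_vertex_design (hN : k + 1 ≤ N) {p' : unitInterval} (A : SlabArmKit k p') {α₄ αₛ : ℝ} (hα₄ : 0 < α₄) (hαₛ1 : αₛ ≤ 1)
    (harm₄ : ∀ σ : ℤ, (σ = 1 ∨ σ = -1) → ∀ b : Site 3, b ∈ slab 3 k →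
      α₄ ≤ (bondPercolation (zdGraph 3) p').real (percolatesVia (withinGraph (zdGraph 3) (steepSet4 k σ b)) b))
    (harmₛ : ∀ σ : ℤ, (σ = 1 ∨ σ = -1) → ∀ b : Site 3, b ∈ slab 3 k →
      αₛ ≤ (bondPercolation (zdGraph 3) p').real
        (percolatesVia (withinGraph (zdGraph 3) {x : Site 3 | x ∈ slab 3 k ∧ (0 ≤ σ * (x 1 - b 1) ∧ 4 * (σ * (x 1 - b 1)) ≤ x 2 - b 2)}) b))
    {u : Site 3} (hu : u ∈ boxSet 3 N)
    (hw : ∃ w, w ∉ boxSet 3 N ∧ (withinGraph (zdGraph 3) {x : Site 3 | x ∈ slab 3 k ∧ (0 ≤ x 1 ∨ 0 ≤ x 2)}).Adj u w) :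
    ∃ E : Set (BondConfig (Site 3)), IsUpperSet E ∧ MeasurableSet E ∧ DeterminedBy E ↑(edgesIn (zdGraph 3) (box 3 (k + 4 * N + 6))) ∧
      α₄ * A.α * αₛ ≤ (bondPercolation (zdGraph 3) p').real E ∧
      ∀ ω ∈ E, ∃ F : Finset (Sym2 (Site 3)), F ⊆ edgesIn (zdGraph 3) (box 3 (k + 4 * N + 6)) ∧ F.card ≤ 2 * k + 2 ∧
        ω ∪ ↑F ∈ openConnVia (starGraph (withinGraph (zdGraph 3) {x : Site 3 | x ∈ slab 3 k ∧ (0 ≤ x 1 ∨ 0 ≤ x 2)}) Set.univ (boxSet 3 N)) u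
          ![0, (N : ℤ) + 1, -(3 * (N : ℤ) + 5)] := by
  obtain ⟨huP, hface⟩ := tq_innerBdry hN hu hw
  obtain ⟨hu0, -⟩ := (mem_tq_iff (k := k)).1 huP
  have hub := mem_boxSet_iff.1 hu
  have hu1 := hub 1; have hu2 := hub 2
  set Ω : Site 3 := ![0, (N : ℤ) + 1, -(3 * (N : ℤ) + 5)] with hΩ_def
  have hΩ0 : Ω 0 = 0 := by simp [hΩ_def]
  have hΩ1 : Ω 1 = (N : ℤ) + 1 := by simp [hΩ_def]
  have hΩ2 : Ω 2 = -(3 * (N : ℤ) + 5) := by simp [hΩ_def]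
  have hΩslab : Ω ∈ slab 3 k := by show 0 ≤ Ω 0 ∧ Ω 0 ≤ (k : ℤ); rw [hΩ0]; exact ⟨le_rfl, by positivity⟩
  have hH : ∀ x ∈ shallowReg k Ω (3 * (N : ℤ) + 5), x ∈ {x : Site 3 | x ∈ slab 3 k ∧ (0 ≤ x 1 ∨ 0 ≤ x 2)} ∧ x ∉ boxSet 3 N ∧
      x 1 ≤ 4 * (N : ℤ) + 6 := fun x hx => tq_station_props hx
  have hwinH : ∀ x ∈ shallowReg k Ω (3 * (N : ℤ) + 5), ∀ j, |x j| ≤ (k + 4 * N + 6 : ℕ) := by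
    intro x hx j
    obtain ⟨h0, h1, h2, h3, hZ⟩ := shallowReg_props hx
    rw [hΩ1] at h1 h2; rw [hΩ2] at h2 h3
    fin_cases j <;> rw [abs_le] <;> push_cast <;> constructor <;> omega
  have hq0 : 0 ≤ α₄ * A.α := (mul_pos hα₄ A.α_pos).le
  have hprobH : A.α ≤ (bondPercolation (zdGraph 3) p').real
      (reachEvent (withinGraph (zdGraph 3) (shallowReg k Ω (3 * (N : ℤ) + 5))) Ω {x | x 2 = 3 * (N : ℤ) + 5}) :=
    le_real_of_subset (percolatesVia_subset_reachEvent_le (self_mem_shallowSet hΩslab) 2 (by rw [hΩ2]; omega)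
      (by simpa only [HalfSlabUniq.shallowReg] using shallowReg_finite (k := k) Ω (3 * (N : ℤ) + 5))) (A.shallow_arm Ω hΩslab)
  -- generic packaging for the faces top/right/left: one thin arm from an apex `b`, crossed by the sweep
  have pack : ∀ {σ : ℤ} (_ : σ = 1 ∨ σ = -1) {b : Site 3} (_ : b ∈ slab 3 k) (_ : -(N : ℤ) ≤ b 1) (_ : b 1 ≤ (N : ℤ) + 1) (_ : |b 2| ≤ (N : ℤ) + 1)
      (_ : ∀ x ∈ steepSet4 k σ b ∩ {x | x 1 ≤ 4 * (N : ℤ) + 6}, x ∈ {x : Site 3 | x ∈ slab 3 k ∧ (0 ≤ x 1 ∨ 0 ≤ x 2)} ∧ x ∉ boxSet 3 N)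
      (Esc : Finset (Sym2 (Site 3))) (_ : Esc ⊆ edgesIn (zdGraph 3) (box 3 (k + 4 * N + 6))) (_ : Esc.card ≤ 2)
      (_ : ∀ (ω : BondConfig (Site 3)) (F : Finset (Sym2 (Site 3))), Esc ⊆ F →
        ω ∪ ↑F ∈ openConnVia (starGraph (withinGraph (zdGraph 3) {x : Site 3 | x ∈ slab 3 k ∧ (0 ≤ x 1 ∨ 0 ≤ x 2)}) Set.univ (boxSet 3 N)) b Ω →
        ω ∪ ↑F ∈ openConnVia (starGraph (withinGraph (zdGraph 3) {x : Site 3 | x ∈ slab 3 k ∧ (0 ≤ x 1 ∨ 0 ≤ x 2)}) Set.univ (boxSet 3 N)) u Ω),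
      ∃ E : Set (BondConfig (Site 3)), IsUpperSet E ∧ MeasurableSet E ∧ DeterminedBy E ↑(edgesIn (zdGraph 3) (box 3 (k + 4 * N + 6))) ∧
        α₄ * A.α * αₛ ≤ (bondPercolation (zdGraph 3) p').real E ∧
        ∀ ω ∈ E, ∃ F : Finset (Sym2 (Site 3)), F ⊆ edgesIn (zdGraph 3) (box 3 (k + 4 * N + 6)) ∧ F.card ≤ 2 * k + 2 ∧
          ω ∪ ↑F ∈ openConnVia (starGraph (withinGraph (zdGraph 3) {x : Site 3 | x ∈ slab 3 k ∧ (0 ≤ x 1 ∨ 0 ≤ x 2)}) Set.univ (boxSet 3 N))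
            u Ω := by
    intro σ hσ b hb hb1lo hb1hi hb2 hSD Esc hEsc hEscc hEscMove
    have hb2' := abs_le.1 hb2
    set T : ℤ := 4 * (N : ℤ) + 6 with hT
    set S : Set (Site 3) := steepSet4 k σ b ∩ {x | x 1 ≤ T} with hS_def
    have hbS : b ∈ S := ⟨self_mem_steepSet4 hb, by show b 1 ≤ T; omega⟩
    have hSprops : ∀ x ∈ S, (0 ≤ x 0 ∧ x 0 ≤ (k : ℤ)) ∧ b 1 ≤ x 1 ∧ x 1 ≤ T ∧ 0 ≤ σ * (x 2 - b 2) ∧ σ * (x 2 - b 2) ≤ 2 * (N : ℤ) + 3 := by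
      rintro x ⟨⟨h0, h1, h2⟩, hxT⟩
      have hxT' : x 1 ≤ T := hxT
      exact ⟨h0, by omega, hxT', h1, by omega⟩
    have hSz : ∀ x ∈ S, Ω 2 ≤ x 2 ∧ x 2 ≤ 3 * (N : ℤ) + 5 := by
      intro x hx
      obtain ⟨-, -, -, h1, h2⟩ := hSprops x hx
      rw [hΩ2]
      rcases hσ with rfl | rfl
      · rw [one_mul] at h1 h2; constructor <;> omega
      · rw [neg_one_mul] at h1 h2; constructor <;> omega
    have hM : ∀ x ∈ S ∪ shallowReg k Ω (3 * (N : ℤ) + 5), ∀ j, |x j| ≤ (k + 4 * N + 6 : ℕ) := by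
      rintro x (hx | hx) j
      · obtain ⟨h0, h1, h2, -, -⟩ := hSprops x hx
        obtain ⟨h3, h4⟩ := hSz x hx
        rw [hΩ2] at h3
        fin_cases j <;> rw [abs_le] <;> push_cast <;> constructor <;> omega
      · exact hwinH x hx j
    set E : Set (BondConfig (Site 3)) := reachEvent (withinGraph (zdGraph 3) S) b {x | x 1 = T} ∩
      reachEvent (withinGraph (zdGraph 3) (shallowReg k Ω (3 * (N : ℤ) + 5))) Ω {x | x 2 = 3 * (N : ℤ) + 5} with hE
    have hSfin : S.Finite := (boxSet_finite _).subset (subset_boxSet_of_abs_le fun x hx => hM x (Or.inl hx))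
    have hprobS : α₄ ≤ (bondPercolation (zdGraph 3) p').real (reachEvent (withinGraph (zdGraph 3) S) b {x | x 1 = T}) :=
      le_real_of_subset (percolatesVia_subset_reachEvent_le (self_mem_steepSet4 hb) 1 (by omega)
        (by simpa [hS_def] using hSfin)) (harm₄ σ hσ b hb)
    refine ⟨E, (isUpperSet_reachEvent _ _ _).inter (isUpperSet_reachEvent _ _ _),
      (measurableSet_reachEvent _ _ _).inter (measurableSet_reachEvent _ _ _), ?_, ?_, fun ω hω => ?_⟩
    · exact ((determinedBy_reachEvent _ _ _).mono (edgeSet_withinGraph_subset_edgesIn (subset_boxSet_of_abs_le fun x hx =>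
        hM x (Or.inl hx)))).inter ((determinedBy_reachEvent _ _ _).mono (edgeSet_withinGraph_subset_edgesIn
          (subset_boxSet_of_abs_le fun x hx => hM x (Or.inr hx))))
    · exact (mul_le_of_le_one_right hq0 hαₛ1).trans (harris2_of_le p' (isUpperSet_reachEvent _ _ _) (isUpperSet_reachEvent _ _ _)
        (measurableSet_reachEvent _ _ _) (measurableSet_reachEvent _ _ _) hα₄.le hprobS hprobH)
    · obtain ⟨F, hFs, hFc, hFr⟩ := move_apex_cyl_region (D := {x : Site 3 | x ∈ slab 3 k ∧ (0 ≤ x 1 ∨ 0 ≤ x 2)}) (by omega) tq_cyl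
        (S := S) (fun x hx => (hSprops x hx).1) hbS hΩslab (by rw [hΩ2]; omega) (by rw [hΩ1]; omega)
        (fun x hx => ⟨(hSD x hx).1, (hSD x hx).2, ⟨(hSprops x hx).2.1, (hSprops x hx).2.2.1⟩, hSz x hx⟩) hH hM hω
      refine ⟨Esc ∪ F, Finset.union_subset hEsc hFs, (Finset.card_union_le _ _).trans (by omega), ?_⟩
      exact hEscMove ω (Esc ∪ F) Finset.subset_union_left (openConnVia_mono_finset Finset.subset_union_right hFr)
  have hwu : ∀ j, |u j| ≤ (k + 4 * N + 6 : ℕ) := abs_le_of_mem_boxSet hu (by omega)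
  rcases hface with htop | hright | ⟨hleft, hleft'⟩ | ⟨hbot, hbot'⟩
  · -- TOP face: escape `u → u + e₁ → u + e₁ + e₂`, thin arm leaning `+e₂`
    set m : Site 3 := u + Pi.single 1 1 with hm_def
    set b : Site 3 := m + Pi.single 2 1 with hb_def
    have hm0 : m 0 = u 0 := by simp [hm_def]
    have hm1 : m 1 = u 1 + 1 := by simp [hm_def]
    have hm2 : m 2 = u 2 := by simp [hm_def]
    have hb0 : b 0 = u 0 := by simp [hb_def, hm0]
    have hb1 : b 1 = u 1 + 1 := by simp [hb_def, hm1]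
    have hb2 : b 2 = u 2 + 1 := by simp [hb_def, hm2]
    have hmP : m ∈ {x : Site 3 | x ∈ slab 3 k ∧ (0 ≤ x 1 ∨ 0 ≤ x 2)} :=
      ⟨by show 0 ≤ m 0 ∧ m 0 ≤ (k : ℤ); rw [hm0]; exact hu0, Or.inl (by rw [hm1, htop]; positivity)⟩
    have hbP : b ∈ {x : Site 3 | x ∈ slab 3 k ∧ (0 ≤ x 1 ∨ 0 ≤ x 2)} :=
      ⟨by show 0 ≤ b 0 ∧ b 0 ≤ (k : ℤ); rw [hb0]; exact hu0, Or.inl (by rw [hb1, htop]; positivity)⟩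
    have hmbox : m ∉ boxSet 3 N := not_mem_boxSet_of_lt (j := 1) (by rw [hm1, abs_of_nonneg (by omega)]; omega)
    have hadj1 : (zdGraph 3).Adj u m := (zdGraph_adj_iff _ _).2 ⟨1, Or.inl rfl⟩
    have hadj2 : (zdGraph 3).Adj m b := (zdGraph_adj_iff _ _).2 ⟨2, Or.inl rfl⟩
    have hwm : ∀ j, |m j| ≤ (k + 4 * N + 6 : ℕ) := abs_le_of_mem_boxSet (add_single_mem_boxSet hu 1) (by omega)
    have hwb : ∀ j, |b j| ≤ (k + 4 * N + 6 : ℕ) := abs_le_of_mem_boxSet (add_single_mem_boxSet (add_single_mem_boxSet hu 1) 2) (by omega)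
    refine pack (Or.inl rfl) hbP.1 (by rw [hb1, htop]; omega) (by rw [hb1, htop]) (by rw [hb2, abs_le]; constructor <;> omega)
      (fun x hx => ?_) {s(u, m), s(m, b)} ?_ (Finset.card_insert_le _ _ |>.trans (by simp)) (fun ω F hEF h => ?_)
    · obtain ⟨⟨h0, h1, h2⟩, -⟩ := hx
      rw [hb2, one_mul] at h1 h2; rw [hb1, htop] at h2
      exact ⟨⟨h0, Or.inl (by omega)⟩, not_mem_boxSet_of_lt (j := 1) (by rw [abs_of_nonneg (by omega)]; omega)⟩
    · intro e he
      rcases Finset.mem_insert.1 he with rfl | he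
      · exact mem_edgesIn_of_adj hadj1 hwu hwm
      · rw [Finset.mem_singleton] at he; rw [he]; exact mem_edgesIn_of_adj hadj2 hwm hwb
    · refine openConnVia_step (dext_adj_of hadj1 huP hmP fun h' => hmbox h'.2) (hEF (Finset.mem_insert_self _ _))
        (openConnVia_step (dext_adj_of hadj2 hmP hbP fun h' => hmbox h'.1) (hEF ?_) h)
      exact Finset.mem_insert_of_mem (Finset.mem_singleton_self _)
  · -- RIGHT face (`u₁ ≥ −N`): escape `u → u + e₂`, thin arm leaning `+e₂`
    set b : Site 3 := u + Pi.single 2 1 with hb_def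
    have hb0 : b 0 = u 0 := by simp [hb_def]
    have hb1 : b 1 = u 1 := by simp [hb_def]
    have hb2 : b 2 = u 2 + 1 := by simp [hb_def]
    have hbP : b ∈ {x : Site 3 | x ∈ slab 3 k ∧ (0 ≤ x 1 ∨ 0 ≤ x 2)} :=
      ⟨by show 0 ≤ b 0 ∧ b 0 ≤ (k : ℤ); rw [hb0]; exact hu0, Or.inr (by rw [hb2, hright]; positivity)⟩
    have hbbox : b ∉ boxSet 3 N := not_mem_boxSet_of_lt (j := 2) (by rw [hb2, hright, abs_of_nonneg (by omega)]; omega)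
    have hadj : (zdGraph 3).Adj u b := (zdGraph_adj_iff _ _).2 ⟨2, Or.inl rfl⟩
    have hwb : ∀ j, |b j| ≤ (k + 4 * N + 6 : ℕ) := abs_le_of_mem_boxSet (add_single_mem_boxSet hu 2) (by omega)
    refine pack (Or.inl rfl) hbP.1 (by rw [hb1]; omega) (by rw [hb1]; omega) (by rw [hb2, hright]; exact abs_le.2 ⟨by omega, by omega⟩)
      (fun x hx => ?_) {s(u, b)} ?_ (by simp) (fun ω F hEF h => ?_)
    · obtain ⟨⟨h0, h1, h2⟩, -⟩ := hx
      rw [hb2, hright, one_mul] at h1 h2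
      exact ⟨⟨h0, Or.inr (by omega)⟩, not_mem_boxSet_of_lt (j := 2) (by rw [abs_of_nonneg (by omega)]; omega)⟩
    · intro e he
      rw [Finset.mem_singleton] at he; rw [he]; exact mem_edgesIn_of_adj hadj hwu hwb
    · exact openConnVia_step (dext_adj_of hadj huP hbP fun h' => hbbox h'.2) (hEF (Finset.mem_singleton_self _)) h
  · -- LEFT face (`u₁ ≥ 0`): escape `u → u − e₂`, thin arm leaning `−e₂` (stays in `{x₁ ≥ 0}`)
    set b : Site 3 := u - Pi.single 2 1 with hb_def
    have hb0 : b 0 = u 0 := by simp [hb_def]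
    have hb1 : b 1 = u 1 := by simp [hb_def]
    have hb2 : b 2 = u 2 - 1 := by simp [hb_def]
    have hbP : b ∈ {x : Site 3 | x ∈ slab 3 k ∧ (0 ≤ x 1 ∨ 0 ≤ x 2)} :=
      ⟨by show 0 ≤ b 0 ∧ b 0 ≤ (k : ℤ); rw [hb0]; exact hu0, Or.inl (by rw [hb1]; exact hleft')⟩
    have hbbox : b ∉ boxSet 3 N := not_mem_boxSet_of_lt (j := 2) (by rw [hb2, hleft, abs_of_nonpos (by omega)]; omega)
    have hadj : (zdGraph 3).Adj u b := (zdGraph_adj_iff _ _).2 ⟨2, Or.inr (by rw [hb_def, sub_add_cancel])⟩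
    have hwb : ∀ j, |b j| ≤ (k + 4 * N + 6 : ℕ) := abs_le_of_mem_boxSet (sub_single_mem_boxSet hu 2) (by omega)
    refine pack (Or.inr rfl) hbP.1 (by rw [hb1]; omega) (by rw [hb1]; omega) (by rw [hb2, hleft]; exact abs_le.2 ⟨by omega, by omega⟩)
      (fun x hx => ?_) {s(u, b)} ?_ (by simp) (fun ω F hEF h => ?_)
    · obtain ⟨⟨h0, h1, h2⟩, -⟩ := hx
      rw [neg_one_mul] at h1 h2; rw [hb1] at h2
      exact ⟨⟨h0, Or.inl (by omega)⟩, not_mem_boxSet_of_lt (j := 2) (by rw [abs_of_nonpos (by omega)]; omega)⟩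
    · intro e he
      rw [Finset.mem_singleton] at he; rw [he]; exact mem_edgesIn_of_adj hadj hwu hwb
    · exact openConnVia_step (dext_adj_of hadj huP hbP fun h' => hbbox h'.2) (hEF (Finset.mem_singleton_self _)) h
  · -- BOTTOM face (`u₂ ≥ 0`): escape `u → u − e₁ =: b`; swapped arm `A₁` from `b` to `{x₂ = T₂}`, connector arm `A₂` from `c`, the sweep
    set b : Site 3 := u - Pi.single 1 1 with hb_def
    have hb0 : b 0 = u 0 := by simp [hb_def]
    have hb1 : b 1 = u 1 - 1 := by simp [hb_def]
    have hb2 : b 2 = u 2 := by simp [hb_def]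
    set c : Site 3 := ![u 0, -(4 * (N : ℤ) + 6), (N : ℤ) + 2] with hc_def
    have hc0 : c 0 = u 0 := by simp [hc_def]
    have hc1 : c 1 = -(4 * (N : ℤ) + 6) := by simp [hc_def]
    have hc2 : c 2 = (N : ℤ) + 2 := by simp [hc_def]
    set T : ℤ := 4 * (N : ℤ) + 6 with hT
    set T₂ : ℤ := 3 * (N : ℤ) + 5 with hT₂
    have hbslab : b ∈ slab 3 k := by show 0 ≤ b 0 ∧ b 0 ≤ (k : ℤ); rw [hb0]; exact hu0
    have hcslab : c ∈ slab 3 k := by show 0 ≤ c 0 ∧ c 0 ≤ (k : ℤ); rw [hc0]; exact hu0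
    have hbP : b ∈ {x : Site 3 | x ∈ slab 3 k ∧ (0 ≤ x 1 ∨ 0 ≤ x 2)} := ⟨hbslab, Or.inr (by rw [hb2]; exact hbot')⟩
    have hbbox : b ∉ boxSet 3 N := not_mem_boxSet_of_lt (j := 1) (by rw [hb1, hbot, abs_of_nonpos (by omega)]; omega)
    have hadj : (zdGraph 3).Adj u b := (zdGraph_adj_iff _ _).2 ⟨1, Or.inr (by rw [hb_def, sub_add_cancel])⟩
    have hwb : ∀ j, |b j| ≤ (k + 4 * N + 6 : ℕ) := abs_le_of_mem_boxSet (sub_single_mem_boxSet hu 1) (by omega)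
    -- the three regions
    set H₁ : Set (Site 3) := {x : Site 3 | x ∈ slab 3 k ∧ (0 ≤ (-1 : ℤ) * (x 1 - b 1) ∧ 4 * ((-1 : ℤ) * (x 1 - b 1)) ≤ x 2 - b 2)} ∩
      {x | x 2 ≤ T₂} with hH₁
    set S₂ : Set (Site 3) := steepSet4 k 1 c ∩ {x | x 1 ≤ T} with hS₂
    have hbH₁ : b ∈ H₁ := ⟨⟨hbslab, by simp, by simp⟩, by show b 2 ≤ T₂; rw [hb2]; omega⟩
    have hcS₂ : c ∈ S₂ := ⟨self_mem_steepSet4 hcslab, by show c 1 ≤ T; rw [hc1]; omega⟩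
    have hH₁props : ∀ x ∈ H₁, (0 ≤ x 0 ∧ x 0 ≤ (k : ℤ)) ∧ (c 1 ≤ x 1 ∧ x 1 ≤ b 1) ∧ (b 2 ≤ x 2 ∧ x 2 ≤ T₂) := by
      rintro x ⟨⟨h0, h1, h2⟩, hxT⟩
      have hxT' : x 2 ≤ T₂ := hxT
      rw [neg_one_mul] at h1 h2
      rw [hc1]; rw [hb1, hbot] at h1 h2 ⊢; rw [hb2] at h2 ⊢
      exact ⟨h0, ⟨by omega, by omega⟩, ⟨by omega, hxT'⟩⟩
    have hS₂props : ∀ x ∈ S₂, (0 ≤ x 0 ∧ x 0 ≤ (k : ℤ)) ∧ (c 1 ≤ x 1 ∧ x 1 ≤ T) ∧ ((N : ℤ) + 2 ≤ x 2 ∧ x 2 ≤ T₂) := by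
      rintro x ⟨⟨h0, h1, h2⟩, hxT⟩
      have hxT' : x 1 ≤ T := hxT
      rw [hc2, one_mul] at h1 h2; rw [hc1] at h2 ⊢
      exact ⟨h0, ⟨by omega, hxT'⟩, ⟨by omega, by omega⟩⟩
    have hH₁D : ∀ x ∈ H₁, x ∈ {x : Site 3 | x ∈ slab 3 k ∧ (0 ≤ x 1 ∨ 0 ≤ x 2)} ∧ x ∉ boxSet 3 N := fun x hx => by
      obtain ⟨h0, ⟨-, h1⟩, ⟨h2, -⟩⟩ := hH₁props x hx
      rw [hb1, hbot] at h1; rw [hb2] at h2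
      exact ⟨⟨h0, Or.inr (by omega)⟩, not_mem_boxSet_of_lt (j := 1) (by rw [abs_of_nonpos (by omega)]; omega)⟩
    have hS₂D : ∀ x ∈ S₂, x ∈ {x : Site 3 | x ∈ slab 3 k ∧ (0 ≤ x 1 ∨ 0 ≤ x 2)} ∧ x ∉ boxSet 3 N := fun x hx => by
      obtain ⟨h0, -, ⟨h2, -⟩⟩ := hS₂props x hx
      exact ⟨⟨h0, Or.inr (by omega)⟩, not_mem_boxSet_of_lt (j := 2) (by rw [abs_of_nonneg (by omega)]; omega)⟩
    have hM₁ : ∀ x ∈ S₂ ∪ H₁, ∀ j, |x j| ≤ (k + 4 * N + 6 : ℕ) := by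
      rintro x (hx | hx) j
      · obtain ⟨h0, ⟨h1, h2⟩, ⟨h3, h4⟩⟩ := hS₂props x hx
        rw [hc1] at h1
        fin_cases j <;> rw [abs_le] <;> push_cast <;> constructor <;> omega
      · obtain ⟨h0, ⟨h1, h2⟩, ⟨h3, h4⟩⟩ := hH₁props x hx
        rw [hc1] at h1; rw [hb1, hbot] at h2; rw [hb2] at h3
        fin_cases j <;> rw [abs_le] <;> push_cast <;> constructor <;> omega
    have hM₂ : ∀ x ∈ S₂ ∪ shallowReg k Ω (3 * (N : ℤ) + 5), ∀ j, |x j| ≤ (k + 4 * N + 6 : ℕ) := by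
      rintro x (hx | hx) j
      · exact hM₁ x (Or.inl hx) j
      · exact hwinH x hx j
    -- the event: `A₂ ∩ sweep`, then `∩ A₁`
    set E₂ : Set (BondConfig (Site 3)) := reachEvent (withinGraph (zdGraph 3) S₂) c {x | x 1 = T} ∩
      reachEvent (withinGraph (zdGraph 3) (shallowReg k Ω (3 * (N : ℤ) + 5))) Ω {x | x 2 = 3 * (N : ℤ) + 5} with hE₂
    set E₁ : Set (BondConfig (Site 3)) := reachEvent (withinGraph (zdGraph 3) H₁) b {x | x 2 = T₂} with hE₁
    have hS₂fin : S₂.Finite := (boxSet_finite _).subset (subset_boxSet_of_abs_le fun x hx => hM₁ x (Or.inl hx))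
    have hH₁fin : H₁.Finite := (boxSet_finite _).subset (subset_boxSet_of_abs_le fun x hx => hM₁ x (Or.inr hx))
    have hprobS₂ : α₄ ≤ (bondPercolation (zdGraph 3) p').real (reachEvent (withinGraph (zdGraph 3) S₂) c {x | x 1 = T}) :=
      le_real_of_subset (percolatesVia_subset_reachEvent_le (self_mem_steepSet4 hcslab) 1 (by rw [hc1]; omega)
        (by simpa [hS₂] using hS₂fin)) (harm₄ 1 (Or.inl rfl) c hcslab)
    have hprobH₁ : αₛ ≤ (bondPercolation (zdGraph 3) p').real E₁ :=
      le_real_of_subset (percolatesVia_subset_reachEvent_le (S := {x : Site 3 | x ∈ slab 3 k ∧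
          (0 ≤ (-1 : ℤ) * (x 1 - b 1) ∧ 4 * ((-1 : ℤ) * (x 1 - b 1)) ≤ x 2 - b 2)}) ⟨hbslab, by simp, by simp⟩ 2 (by rw [hb2]; omega)
        (by simpa [hH₁] using hH₁fin)) (harmₛ (-1) (Or.inr rfl) b hbslab)
    have hE₂upper : IsUpperSet E₂ := (isUpperSet_reachEvent _ _ _).inter (isUpperSet_reachEvent _ _ _)
    have hE₂meas : MeasurableSet E₂ := (measurableSet_reachEvent _ _ _).inter (measurableSet_reachEvent _ _ _)
    have hprobE₂ : α₄ * A.α ≤ (bondPercolation (zdGraph 3) p').real E₂ :=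
      harris2_of_le p' (isUpperSet_reachEvent _ _ _) (isUpperSet_reachEvent _ _ _) (measurableSet_reachEvent _ _ _)
        (measurableSet_reachEvent _ _ _) hα₄.le hprobS₂ hprobH
    refine ⟨E₂ ∩ E₁, hE₂upper.inter (isUpperSet_reachEvent _ _ _), hE₂meas.inter (measurableSet_reachEvent _ _ _), ?_, ?_,
      fun ω hω => ?_⟩
    · exact (((determinedBy_reachEvent _ _ _).mono (edgeSet_withinGraph_subset_edgesIn (subset_boxSet_of_abs_le fun x hx =>
        hM₁ x (Or.inl hx)))).inter ((determinedBy_reachEvent _ _ _).mono (edgeSet_withinGraph_subset_edgesIn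
          (subset_boxSet_of_abs_le fun x hx => hwinH x hx)))).inter
        ((determinedBy_reachEvent _ _ _).mono (edgeSet_withinGraph_subset_edgesIn (subset_boxSet_of_abs_le fun x hx => hM₁ x (Or.inr hx))))
    · exact harris2_of_le p' hE₂upper (isUpperSet_reachEvent _ _ _) hE₂meas (measurableSet_reachEvent _ _ _) hq0 hprobE₂ hprobH₁
    · obtain ⟨hω₂, hω₁⟩ := hω
      -- link 2: connector arm × sweep, `c ↔ Ω` with `≤ k` edges
      obtain ⟨F₂, hF₂s, hF₂c, hF₂r⟩ := move_apex_cyl_region (D := {x : Site 3 | x ∈ slab 3 k ∧ (0 ≤ x 1 ∨ 0 ≤ x 2)}) (by omega) tq_cyl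
        (S := S₂) (fun x hx => (hS₂props x hx).1) hcS₂ hΩslab (by rw [hΩ2]; omega) (by rw [hc1, hΩ1]; omega)
        (fun x hx => ⟨(hS₂D x hx).1, (hS₂D x hx).2, (hS₂props x hx).2.1, by
          obtain ⟨-, -, h3, h4⟩ := hS₂props x hx; rw [hΩ2]; exact ⟨by omega, by omega⟩⟩) hH hM₂ hω₂
      -- link 1: connector arm (vertical from `c`) × swapped arm (horizontal from `b`), `c ↔ b` with `≤ k` edges
      have hKJ : ∀ s ∈ S₂, ∀ t ∈ H₁, s 1 = t 1 → s 2 = t 2 →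
          withinGraph (zdGraph 3) {z | ∀ j, min (s j) (t j) ≤ z j ∧ z j ≤ max (s j) (t j)} ≤
            starGraph (withinGraph (zdGraph 3) {x : Site 3 | x ∈ slab 3 k ∧ (0 ≤ x 1 ∨ 0 ≤ x 2)}) Set.univ (boxSet 3 N) := by
        intro s hs t ht h1 h2
        refine withinGraph_le_dext fun z hz => ?_
        obtain ⟨hs0, -, ⟨hs2, -⟩⟩ := hS₂props s hs
        obtain ⟨ht0, -, -⟩ := hH₁props t ht
        have hz2 : z 2 = s 2 := eq_of_mem_bbox hz h2
        have hz0 := hz 0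
        refine ⟨⟨⟨le_trans (le_min hs0.1 ht0.1) hz0.1, le_trans hz0.2 (max_le hs0.2 ht0.2)⟩, Or.inr (by rw [hz2]; omega)⟩,
          not_mem_boxSet_of_lt (j := 2) ?_⟩
        rw [hz2, abs_of_nonneg (by omega)]; omega
      obtain ⟨F₁, hF₁s, hF₁c, hF₁r⟩ := link_regions (S := S₂) (H := H₁) (fun x hx => (hS₂props x hx).1) (fun x hx => (hH₁props x hx).1)
        hcS₂ hbH₁ (fun x hx => ⟨(hS₂props x hx).2.1.1, (hS₂props x hx).2.1.2, by
          rw [hb2]; have := (hS₂props x hx).2.2.1; have := hu2.2; omega, (hS₂props x hx).2.2.2⟩)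
        (fun x hx => ⟨(hH₁props x hx).2.1.1, (hH₁props x hx).2.1.2.trans (by rw [hb1]; omega), (hH₁props x hx).2.2.1,
          (hH₁props x hx).2.2.2⟩)
        (withinGraph_le_dext hS₂D) (withinGraph_le_dext hH₁D) hKJ hM₁ ⟨hω₂.1, hω₁⟩
      -- compose: `u → b` (escape), `b ↔ c` (link 1, reversed), `c ↔ Ω` (link 2)
      have hbc : ω ∪ ↑F₁ ∈ openConnVia (starGraph (withinGraph (zdGraph 3) {x : Site 3 | x ∈ slab 3 k ∧ (0 ≤ x 1 ∨ 0 ≤ x 2)})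
          Set.univ (boxSet 3 N)) b c := mem_openConnVia_iff.2 (mem_openConnVia_iff.1 hF₁r).symm
      have hbΩ := openConnVia_trans hbc hF₂r
      have hcard : (insert s(u, b) (F₁ ∪ F₂)).card ≤ 2 * k + 2 :=
        (Finset.card_insert_le _ _).trans (by have := Finset.card_union_le F₁ F₂; omega)
      refine ⟨insert s(u, b) (F₁ ∪ F₂), ?_, hcard, ?_⟩
      · intro e he
        rcases Finset.mem_insert.1 he with rfl | he
        · exact mem_edgesIn_of_adj hadj hwu hwb
        · rcases Finset.mem_union.1 he with he | he
          · exact hF₁s he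
          · exact hF₂s he
      · exact openConnVia_step (dext_adj_of hadj huP hbP fun h' => hbbox h'.2) (Finset.mem_insert_self _ _)
          (openConnVia_mono_finset (Finset.subset_insert _ _) hbΩ)

end ThreeQuarterSlab

end Summit.CriticalPhenomena.PercolationContinuityZ3.Theorems.Transplant

end
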